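import Summits.BirchSwinnertonDyer.Rank1Residual.GaloisImage.KolyvaginSystemsCoreRankZero
import Summits.BirchSwinnertonDyer.Rank1Residual.X11b.WeilTransport
import HarnessLib

/-!
# Core vertices of the Selmer graph at the residual level `m = 1`: bookkeeping
# (Rubin, PCMI Lecture 2, §2.5–2.6; Sakamoto, JTNB 36 (2024) §3.1.2, §6 — the case `R = 𝔽_p`)
# (cell `b2b-bsdres`, team n1011, ROUTE-1 item R1-56 (G) = row T-R1-56-G, file G1; seat p11;
# skeleton `cells/n1011/skel/T-R1-56-G.md`)

HONEST FRAMING (verbatim for the cell): research route; prove what is provable now; no claim beyond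
stated classes; nothing booked; no mark / label moved.  TOOL theorems about Selmer structures of a
finite Galois module killed by a prime `p`; theorems only — no definition, no named fact.

## Setting and content

`K` a number field, `M = T̄` a finite discrete `Γ_K`-module with `p·M = 0`, `inv` a family of local
invariant maps with the Poitou–Tate properties (the tree's fact `poitouTate_selmerStructure_duality`
provides one), `𝓕` a Selmer structure unramified outside a finite `S`, `D` a Kolyvagin datum
(`Literature/…/GaloisCohomology/KolyvaginSystems.lean`) whose primes `𝒫` lie outside `S`, with
admissible comparison maps and the local shape `#H¹_ur(K_𝔮, M) = #H¹_tr(K_𝔮, M) = p`,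
`H¹ = H¹_ur + H¹_tr` at `𝔮 ∈ 𝒫` (Rubin Prop. 1.9.5 / Ex. 1.9.7) — exactly the setting of R1-16
(`CoreRankZero.kolyvaginSystems_eq_bot_of_hasCoreRank_zero`).  Writing `H(n) = H¹_{𝓕(n)}(K, M)` and
`H^*(n) = H¹_{𝓕(n)^*}(K, M^D)` for a level `n`:
* §1 local consequences at `𝔮 ∈ 𝒫`: `#H¹(K_𝔮, M) = p²`, `H¹_ur ∩ H¹_tr = 0`, `(H¹_ur)^* ∩ (H¹_tr)^* = 0`;
* §2 **the core rank is one at every level**: `χ(𝓕) = 1` (`HasCoreRank inv 𝓕 p 1`) gives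
  `#H(n) = p · #H^*(n)` for every level `n` (Rubin Ex. 2.1.4 / Sakamoto Lemma 3.7 (1):
  `χ(𝓕(n)) = χ(𝓕)`), so that at a CORE VERTEX (`H^*(n) = 0`; Rubin Def. 2.5.3, Sakamoto §6) the
  group `H(n)` is cyclic of order `p` (Rubin Ex. 2.5.4 (2));
* §3 the residual self-duality `θ : M ⥲ M^D` (Sakamoto's (H.SD), with an inverse `θ′`): the
  transported dual Selmer group `H†(n) := H¹_{θ^*𝓕(n)^*}(K, M)` (the tree's `dualTransported`,
  Sakamoto §3.1.2 "we regard `𝓕^*` as a Selmer structure on `T̄`") is in bijection with `H^*(n)`,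
  and **if `𝓕` is residually coisotropic (Sakamoto Def. 3.8) then `H†(n) ≤ H(n)` at EVERY level**
  (Sakamoto p. 931: "By the coisotropy `𝓕^* ⊂ 𝓕`, we have `H¹_{𝓕^*(e)}(K,T̄) ⊂ H¹_{𝓕(e)}(K,T̄)`"),
  the unramified condition being self-dual (Milne I Thm. 2.6, the family's `UnramifiedOrthogonal`)
  and the transverse condition at `𝒫` being self-dual under `θ` by hypothesis (`hTθ`; for the
  cyclotomic transverse condition this is Mazur–Rubin Prop. 1.3.2 (ii), the tree's
  `TransverseOrthogonal`, discharged by the consumer).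

## References

* [Rubin2011] K. Rubin, *Euler systems and Kolyvagin systems*, IAS/Park City Math. Ser. 18 (2011),
  Lecture 2: Ex. 2.1.4, Def. 2.5.3, Ex. 2.5.4, Prop. 2.6.1, Cor. 2.6.2 (pp. 18–23) — read (held,
  doi:10.1090/pcms/018/14).
* [Sakamoto2024] R. Sakamoto, *The theory of Kolyvagin systems for `p = 3`*, J. Théor. Nombres
  Bordeaux 36 (2024) 919–946: §3.1.2 (Def. 3.8, p. 924), Lemma 3.7 (p. 923), §6 (pp. 930–932) — read
  (OA PDF).
* B. Mazur, K. Rubin, *Kolyvagin systems*, Mem. AMS 799 (2004), §4.1, §4.3 — cited through the two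
  sources above (not held, acq-02261).
-/

noncomputable section

open scoped Classical NumberField ContRepresentation
open Function NumberField IsDedekindDomain
open Literature.NumberTheory.GaloisRepresentations Literature.NumberTheory.GaloisRepresentations.DiscreteGaloisModule
  Literature.NumberTheory.GaloisCohomology
open Summit.BirchSwinnertonDyer.Rank1Residual.GaloisImage.CoreRankZero
open Summit.BirchSwinnertonDyer.Rank1Residual.X11b.Levels

universe u

namespace Summit.BirchSwinnertonDyer.Rank1Residual.GaloisImage.CoreRankOne

variable {K : Type u} [Field K] [NumberField K]
variable {M : Type u} [AddCommGroup M] [TopologicalSpace M] [DiscreteTopology M] [Finite M]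
variable {ρ : DiscreteGaloisModule K M}

/-! ## §0. Two lemmas on subgroups of prime order -/

/-- A non-trivial subgroup of a group of prime order is everything. [folklore] -/
theorem eq_of_le_of_natCard_eq_prime {G : Type*} [AddCommGroup G] {p : ℕ} (hp : p.Prime)
    {A B : AddSubgroup G} (hle : A ≤ B) (hB : Nat.card B = p) (hA : A ≠ ⊥) : A = B := by
  haveI : Finite B := Nat.finite_of_card_ne_zero (by rw [hB]; exact hp.ne_zero)
  have hdvd := AddSubgroup.card_dvd_of_le hle
  rw [hB] at hdvd
  rcases (Nat.dvd_prime hp).1 hdvd with h1 | hpA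
  · exact absurd (AddSubgroup.card_eq_one.1 h1) hA
  · exact AddSubgroup.eq_of_le_of_card_ge hle (by rw [hB, hpA])

/-- A subgroup of a group of prime order missing one of its elements is trivial. [folklore] -/
theorem eq_bot_of_le_of_natCard_eq_prime_of_not_mem {G : Type*} [AddCommGroup G] {p : ℕ}
    (hp : p.Prime) {A B : AddSubgroup G} (hle : A ≤ B) (hB : Nat.card B = p) {b : G} (hb : b ∈ B)
    (hbA : b ∉ A) : A = ⊥ := by
  by_contra hA
  exact hbA ((eq_of_le_of_natCard_eq_prime hp hle hB hA).symm ▸ hb)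

/-- In a group of prime order `p`, every non-zero element generates. [folklore] -/
theorem eq_zmultiples_of_natCard_eq_prime {G : Type*} [AddCommGroup G] {p : ℕ} (hp : p.Prime)
    {B : AddSubgroup G} (hB : Nat.card B = p) {x : G} (hx : x ∈ B) (hx0 : x ≠ 0) :
    AddSubgroup.zmultiples x = B :=
  eq_of_le_of_natCard_eq_prime hp ((AddSubgroup.zmultiples_le).2 hx) hB
    (by rwa [Ne, AddSubgroup.zmultiples_eq_bot])

/-! ## §1. Local consequences of the Kolyvagin-prime shape -/

omit [Finite M] in
/-- **`#H¹(K_𝔮, M) = p²` at a Kolyvagin prime**: the admissible comparison map is a bijection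
`H¹_ur(K_𝔮, M) ⥲ H¹(K_𝔮, M)/H¹_ur(K_𝔮, M)`, so both have order `p` (Rubin Ex. 1.9.7: "`H¹_u` and
`H¹_t` are free of rank one and `φ^{ut}` is an isomorphism"). [cite: Rubin2011, Exercise 1.9.7 (p. 15)] -/
theorem natCard_galoisCohomology_toLocal_eq {p : ℕ} {D : KolyvaginDatum ρ} (hadm : D.IsAdmissible)
    (hU : ∀ q ∈ D.primes, Nat.card (unramifiedSubgroup (GaloisRep.toLocal q ρ) 1) = p)
    {q : HeightOneSpectrum (𝓞 K)} [Finite (galoisCohomology (GaloisRep.toLocal q ρ) 1)]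
    (hq : q ∈ D.primes) :
    Nat.card (galoisCohomology (GaloisRep.toLocal q ρ) 1) = p * p := by
  have h1 : Nat.card (SingularQuotient (GaloisRep.toLocal q ρ)) = p := by
    rw [← hU q hq]; exact (Nat.card_eq_of_bijective _ (hadm q hq)).symm
  rw [AddSubgroup.card_eq_card_quotient_mul_card_addSubgroup
    (unramifiedSubgroup (GaloisRep.toLocal q ρ) 1), hU q hq]
  exact congrArg (· * p) h1

/-- **`H¹_ur(K_𝔮, M) ∩ H¹_tr(K_𝔮, M) = 0` at a Kolyvagin prime** (the splitting
`H¹ = H¹_ur ⊕ H¹_tr`, Mazur–Rubin Lemma 1.2.4 / Sakamoto §4 p. 925 "a functorial splitting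
`H¹(K_𝔮,T) = H¹_ur(K_𝔮,T) ⊕ H¹_tr(K_𝔮,T)`"): the addition map `H¹_ur × H¹_tr → H¹` is onto
(`H¹_ur + H¹_tr = H¹`) between groups of the same order `p²`, hence injective.
[cite: Sakamoto2024, §4 (p. 925)] [cite: Rubin2011, Prop. 1.9.5 (1) (p. 14)] -/
theorem unramified_inf_transverse_eq_bot {p : ℕ} {D : KolyvaginDatum ρ} (hadm : D.IsAdmissible)
    (hU : ∀ q ∈ D.primes, Nat.card (unramifiedSubgroup (GaloisRep.toLocal q ρ) 1) = p)
    (hT : ∀ q ∈ D.primes, Nat.card (D.transverse (Sum.inr q)) = p)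
    (hUT : ∀ q ∈ D.primes,
      unramifiedSubgroup (GaloisRep.toLocal q ρ) 1 ⊔ D.transverse (Sum.inr q) = ⊤)
    {q : HeightOneSpectrum (𝓞 K)} (hq : q ∈ D.primes) :
    unramifiedSubgroup (GaloisRep.toLocal q ρ) 1 ⊓ D.transverse (Sum.inr q) = ⊥ := by
  haveI : Finite (galoisCohomology (GaloisRep.toLocal q ρ) 1) := finite_galoisCohomology_one_toLocal ρ q
  set U : AddSubgroup (galoisCohomology (GaloisRep.toLocal q ρ) 1) :=
    unramifiedSubgroup (GaloisRep.toLocal q ρ) 1 with hUdef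
  set T : AddSubgroup (galoisCohomology (GaloisRep.toLocal q ρ) 1) := D.transverse (Sum.inr q)
    with hTdef
  let f : U × T →+ galoisCohomology (GaloisRep.toLocal q ρ) 1 :=
    AddMonoidHom.coprod U.subtype T.subtype
  have hf : ∀ (u : U) (t : T), f (u, t) = (u : galoisCohomology (GaloisRep.toLocal q ρ) 1) +
      (t : galoisCohomology (GaloisRep.toLocal q ρ) 1) := fun u t => by
    simp only [f, AddMonoidHom.coprod_apply, AddSubgroup.coe_subtype]
  have hsurj : Function.Surjective f := by
    intro x
    have hx : x ∈ U ⊔ T := by rw [hUT q hq]; exact AddSubgroup.mem_top x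
    obtain ⟨u, hu, t, ht, rfl⟩ := AddSubgroup.mem_sup.1 hx
    exact ⟨(⟨u, hu⟩, ⟨t, ht⟩), hf _ _⟩
  have hcard : Nat.card (U × T) = Nat.card (galoisCohomology (GaloisRep.toLocal q ρ) 1) := by
    rw [Nat.card_prod, natCard_galoisCohomology_toLocal_eq hadm hU hq, hUdef, hU q hq, hTdef]
    exact congrArg (p * ·) (hT q hq)
  haveI : Finite (U × T) := Finite.instProd
  have hbij := hsurj.bijective_of_nat_card_le hcard.le
  rw [eq_bot_iff]
  rintro x ⟨hxU, hxT⟩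
  rw [AddSubgroup.mem_bot]
  have h0 : f (⟨x, hxU⟩, ⟨-x, neg_mem hxT⟩) = f 0 := by rw [hf, map_zero]; exact add_neg_cancel x
  have h1 := congrArg (fun z : U × T => ((z.1 : U) : galoisCohomology (GaloisRep.toLocal q ρ) 1))
    (hbij.1 h0)
  simpa using h1

/-- **`(H¹_ur)^* ∩ (H¹_tr)^* = 0` in `H¹(K_𝔮, M^D)` at a Kolyvagin prime**: the annihilator of
`H¹_ur + H¹_tr = H¹(K_𝔮, M)` under a perfect local pairing is zero (R1-16
`dualLocalCondition_sup`, `dualLocalCondition_top_of_isPerfect`). [cite: Rubin2011, Prop. 1.9.5 (p. 14)] -/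
theorem dual_unramified_inf_dual_transverse_eq_bot {p : ℕ} {inv : LocalInvariants K p}
    (hperf : inv.IsPerfect) (hM : ∀ m : M, p • m = 0) {D : KolyvaginDatum ρ}
    (hUT : ∀ q ∈ D.primes,
      unramifiedSubgroup (GaloisRep.toLocal q ρ) 1 ⊔ D.transverse (Sum.inr q) = ⊤)
    {q : HeightOneSpectrum (𝓞 K)} (hq : q ∈ D.primes) :
    inv.dualLocalCondition ρ (Sum.inr q) (unramifiedSubgroup (GaloisRep.toLocal q ρ) 1) ⊓
        inv.dualLocalCondition ρ (Sum.inr q) (D.transverse (Sum.inr q)) = ⊥ := by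
  have hUT' : (max (unramifiedSubgroup (GaloisRep.toLocal q ρ) 1) (D.transverse (Sum.inr q)) :
      AddSubgroup (galoisCohomology (ρ.toLocal (Sum.inr q)) 1)) = ⊤ := hUT q hq
  rw [← dualLocalCondition_sup, hUT', dualLocalCondition_top_of_isPerfect hperf ρ hM q]

/-! ## §2. The core rank is one at every level; core vertices -/

/-- **`#H¹_{𝓕(n)}(K, M) = p · #H¹_{𝓕(n)^*}(K, M^D)` at every level `n`** when `χ(𝓕) = 1`
(`HasCoreRank inv 𝓕 p 1`): the difference `λ(n) − λ^*(n)` is independent of `n` (Rubin Ex. 2.1.4 =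
Mazur–Rubin Cor. 2.3.6, R1-16 `card_selmerGroup_atLevel_mul`) and equals `1` at `n = 1`
(Sakamoto Lemma 3.7 (1): "`χ(𝓕) = χ(𝓕(c))`"). [cite: Rubin2011, Exercise 2.1.4 (p. 18)]
[cite: Sakamoto2024, Lemma 3.7 (1) (p. 923)] -/
theorem natCard_selmerGroup_atLevel_eq_mul {p : ℕ} [Fact p.Prime] {inv : LocalInvariants K p}
    (hperf : inv.IsPerfect) (hsum : inv.SumLocalTermEqZero) (hcompl : inv.SelmerComplement)
    (hM : ∀ m : M, p • m = 0) {S : Finset (Place K)}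
    (hS : ∀ v : HeightOneSpectrum (𝓞 K), (Sum.inr v : Place K) ∉ S →
      ((p : ℕ) : 𝓞 K) ∉ v.asIdeal ∧ GaloisRep.IsUnramifiedAt v ρ)
    {𝓕 : SelmerStructure ρ} (h𝓕 : 𝓕.IsUnramifiedOutside S)
    (hfin : Finite 𝓕.selmerGroup) (hfind : Finite (inv.dualSelmerStructure ρ 𝓕).selmerGroup)
    (hχ : LocalInvariants.HasCoreRank inv 𝓕 p 1)
    {D : KolyvaginDatum ρ} (hPS : ∀ q ∈ D.primes, (Sum.inr q : Place K) ∉ S)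
    (hU : ∀ q ∈ D.primes, Nat.card (unramifiedSubgroup (GaloisRep.toLocal q ρ) 1) = p)
    (hT : ∀ q ∈ D.primes, Nat.card (D.transverse (Sum.inr q)) = p)
    {d : Finset (HeightOneSpectrum (𝓞 K))} (hd : D.IsLevel d) :
    Nat.card (D.atLevel 𝓕 d).selmerGroup =
      p * Nat.card (inv.dualSelmerStructure ρ (D.atLevel 𝓕 d)).selmerGroup := by
  have hmul := card_selmerGroup_atLevel_mul hperf hsum hcompl hM hS h𝓕 hfin hfind hPS
    (fun q hq => by rw [hU q hq, hT q hq]) hd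
  rw [LocalInvariants.HasCoreRank, pow_one] at hχ
  rw [hχ] at hmul
  have h0 : Nat.card (inv.dualSelmerStructure ρ 𝓕).selmerGroup ≠ 0 := Nat.card_pos.ne'
  refine mul_right_cancel₀ h0 ?_
  calc Nat.card (D.atLevel 𝓕 d).selmerGroup * Nat.card (inv.dualSelmerStructure ρ 𝓕).selmerGroup
      = p * Nat.card (inv.dualSelmerStructure ρ 𝓕).selmerGroup *
          Nat.card (inv.dualSelmerStructure ρ (D.atLevel 𝓕 d)).selmerGroup := hmul
    _ = p * Nat.card (inv.dualSelmerStructure ρ (D.atLevel 𝓕 d)).selmerGroup *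
          Nat.card (inv.dualSelmerStructure ρ 𝓕).selmerGroup := by ring

/-- **At a core vertex `H¹_{𝓕(n)}(K, M)` has order `p`** (Rubin Ex. 2.5.4 (2) at `χ = 1`, `m = 1`:
"if `n` is a core vertex, then `H¹_{𝓕(n)}(ℚ, A)` is free over `R` of rank `χ(A)`"; Sakamoto §6:
the vertices of `X⁰` are the levels with `λ^*(d) = 0`). [cite: Rubin2011, Exercise 2.5.4 (2) (p. 21)]
[cite: Sakamoto2024, §6 (p. 930)] -/
theorem natCard_selmerGroup_atLevel_of_core {p : ℕ} [Fact p.Prime] {inv : LocalInvariants K p}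
    (hperf : inv.IsPerfect) (hsum : inv.SumLocalTermEqZero) (hcompl : inv.SelmerComplement)
    (hM : ∀ m : M, p • m = 0) {S : Finset (Place K)}
    (hS : ∀ v : HeightOneSpectrum (𝓞 K), (Sum.inr v : Place K) ∉ S →
      ((p : ℕ) : 𝓞 K) ∉ v.asIdeal ∧ GaloisRep.IsUnramifiedAt v ρ)
    {𝓕 : SelmerStructure ρ} (h𝓕 : 𝓕.IsUnramifiedOutside S)
    (hfin : Finite 𝓕.selmerGroup) (hfind : Finite (inv.dualSelmerStructure ρ 𝓕).selmerGroup)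
    (hχ : LocalInvariants.HasCoreRank inv 𝓕 p 1)
    {D : KolyvaginDatum ρ} (hPS : ∀ q ∈ D.primes, (Sum.inr q : Place K) ∉ S)
    (hU : ∀ q ∈ D.primes, Nat.card (unramifiedSubgroup (GaloisRep.toLocal q ρ) 1) = p)
    (hT : ∀ q ∈ D.primes, Nat.card (D.transverse (Sum.inr q)) = p)
    {d : Finset (HeightOneSpectrum (𝓞 K))} (hd : D.IsLevel d)
    (hcore : (inv.dualSelmerStructure ρ (D.atLevel 𝓕 d)).selmerGroup = ⊥) :
    Nat.card (D.atLevel 𝓕 d).selmerGroup = p := by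
  rw [natCard_selmerGroup_atLevel_eq_mul hperf hsum hcompl hM hS h𝓕 hfin hfind hχ hPS hU hT hd, hcore,
    AddSubgroup.card_bot, mul_one]

/-! ## §3. The residual self-duality `θ : M → M^D` and the transported dual Selmer group -/

section Theta

variable {p : ℕ} (θ : ρ.toContRepresentation →ⁱL (ρ.tateDual p).toContRepresentation)
  (θ' : (ρ.tateDual p).toContRepresentation →ⁱL ρ.toContRepresentation)

/-- `H¹(θ′_v) (H¹(θ_v) x) = x` on `H¹(K_v, M)` when `θ′ ∘ θ = id` (X11b
`map_map_eq_self_of_comp_eq` over the completion). [folklore] -/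
theorem localMap_localMap_eq_self (hθθ' : ∀ a : M, θ' (θ a) = a) (v : Place K)
    (x : galoisCohomology (ρ.toLocal v) 1) : localMap θ' v (localMap θ v x) = x :=
  map_map_eq_self_of_comp_eq (ρ₁ := ρ.toLocal v) (ρ₂ := (ρ.tateDual p).toLocal v) _ _ hθθ' x

/-- `H¹(θ_v)` is injective on `H¹(K_v, M)` when `θ′ ∘ θ = id`. [folklore] -/
theorem localMap_injective (hθθ' : ∀ a : M, θ' (θ a) = a) (v : Place K) :
    Function.Injective (localMap θ v) :=
  Function.LeftInverse.injective (g := localMap θ' v) (localMap_localMap_eq_self θ θ' hθθ' v)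

/-- `loc_v (H¹(θ) x) ≠ 0 ↔ loc_v x ≠ 0`: localisation commutes with the change of coefficients
(R1-16 `localization_map_one_eq`) and `H¹(θ_v)` is injective. [folklore] -/
theorem localization_map_ne_zero_iff (hθθ' : ∀ a : M, θ' (θ a) = a) (v : Place K)
    (x : galoisCohomology ρ 1) :
    galoisCohomology.localization (ρ.tateDual p) v 1 (galoisCohomology.map θ 1 x) ≠ 0 ↔
      galoisCohomology.localization ρ v 1 x ≠ 0 := by
  rw [localization_map_one_eq]
  refine not_congr ⟨fun h => ?_, fun h => by rw [h]; exact map_zero _⟩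
  exact localMap_injective θ θ' hθθ' v (by rw [map_zero]; exact h)

/-- Membership in the **transported dual Selmer group** `H¹_{θ^*𝓖^*}(K, M)` (the Selmer group of
the tree's `dualTransported inv 𝓖 θ`; Sakamoto §3.1.2 "we regard `𝓕^*` as a Selmer structure on
`T̄`"): `x ∈ H¹_{θ^*𝓖^*}(K, M) ↔ H¹(θ) x ∈ H¹_{𝓖^*}(K, M^D)`. [cite: Sakamoto2024, §3.1.2 (p. 924)] -/
theorem mem_selmerGroup_dualTransported_iff (inv : LocalInvariants K p) (𝓖 : SelmerStructure ρ)
    (x : galoisCohomology ρ 1) :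
    x ∈ (inv.dualTransported 𝓖 θ).selmerGroup ↔
      galoisCohomology.map θ 1 x ∈ (inv.dualSelmerStructure ρ 𝓖).selmerGroup := by
  simp only [SelmerStructure.mem_selmerGroup_iff, localization_map_one_eq]
  exact Iff.rfl

/-- **`#H¹_{θ^*𝓖^*}(K, M) = #H¹_{𝓖^*}(K, M^D)`**: `H¹(θ)` restricts to a bijection between the
transported dual Selmer group and the dual Selmer group (inverse `H¹(θ′)`).
[cite: Sakamoto2024, §3.1.2 (p. 924)] -/
theorem natCard_selmerGroup_dualTransported_eq (hθθ' : ∀ a : M, θ' (θ a) = a)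
    (hθ'θ : ∀ b, θ (θ' b) = b) (inv : LocalInvariants K p) (𝓖 : SelmerStructure ρ) :
    Nat.card (inv.dualTransported 𝓖 θ).selmerGroup =
      Nat.card (inv.dualSelmerStructure ρ 𝓖).selmerGroup := by
  have hmem : ∀ y ∈ (inv.dualSelmerStructure ρ 𝓖).selmerGroup,
      galoisCohomology.map θ' 1 y ∈ (inv.dualTransported 𝓖 θ).selmerGroup := fun y hy => by
    rw [mem_selmerGroup_dualTransported_iff, map_map_eq_self_of_comp_eq θ' θ hθ'θ]
    exact hy
  refine Nat.card_eq_of_bijective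
    (fun x => ⟨galoisCohomology.map θ 1 x.1, (mem_selmerGroup_dualTransported_iff θ inv 𝓖 x.1).1 x.2⟩)
    ⟨fun x y hxy => Subtype.ext (map_injective_of_comp_eq θ θ' hθθ' (congrArg Subtype.val hxy)),
      fun y => ⟨⟨galoisCohomology.map θ' 1 y.1, hmem y.1 y.2⟩,
        Subtype.ext (map_map_eq_self_of_comp_eq θ' θ hθ'θ y.1)⟩⟩

/-- **The unramified condition is self-dual under `θ`**: at a finite place `v ∤ p` where `M` is
unramified, `θ_v^{-1}(H¹_ur(K_v, M)^*) = θ_v^{-1}(H¹_ur(K_v, M^D)) = H¹_ur(K_v, M)` (Milne I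
Thm. 2.6 = the family's `UnramifiedOrthogonal`, and intertwining maps preserve unramified classes,
X11b `map_mem_unramifiedSubgroup`). [cite: MilneADT2006, Ch. I, Thm. 2.6] -/
theorem comap_dualLocalCondition_unramifiedSubgroup_eq {inv : LocalInvariants K p}
    (hur : inv.UnramifiedOrthogonal) (hM : ∀ m : M, p • m = 0) (hθθ' : ∀ a : M, θ' (θ a) = a)
    {v : HeightOneSpectrum (𝓞 K)} (hvp : ((p : ℕ) : 𝓞 K) ∉ v.asIdeal)
    (hvρ : GaloisRep.IsUnramifiedAt v ρ) :
    (inv.dualLocalCondition ρ (Sum.inr v) (unramifiedSubgroup (GaloisRep.toLocal v ρ) 1)).comap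
        (localMap θ (Sum.inr v)) = unramifiedSubgroup (GaloisRep.toLocal v ρ) 1 := by
  rw [(hur ρ hM v hvp hvρ).1]
  ext x
  rw [AddSubgroup.mem_comap]
  refine ⟨fun hx => ?_, fun hx => ?_⟩
  · have h := map_mem_unramifiedSubgroup (ρ₁ := GaloisRep.toLocal v (ρ.tateDual p))
      (ρ₂ := GaloisRep.toLocal v ρ) (θ'.restrictField (v.adicCompletion K)) hx
    have h' := localMap_localMap_eq_self θ θ' hθθ' (Sum.inr v) x
    change localMap θ' (Sum.inr v) (localMap θ (Sum.inr v) x) ∈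
      unramifiedSubgroup (GaloisRep.toLocal v ρ) 1 at h
    rwa [h'] at h
  · exact map_mem_unramifiedSubgroup (ρ₁ := GaloisRep.toLocal v ρ)
      (ρ₂ := GaloisRep.toLocal v (ρ.tateDual p)) (θ.restrictField (v.adicCompletion K)) hx

/-- **Coisotropy at every level.** If `𝓕` is residually coisotropic on `S` (Sakamoto Def. 3.8:
`H¹_{𝓕̄^*}(K_𝔮, T̄) ⊂ H¹_{𝓕̄}(K_𝔮, T̄)` for `𝔮 ∈ S(𝓕)`), unramified outside `S ∌ 𝒫`, and the
transverse condition at the primes of `𝒫` is self-dual under `θ` (`hTθ`), then for every level `n`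
the transported dual structure of `𝓕(n)` is contained in `𝓕(n)` at EVERY place.
[cite: Sakamoto2024, Def. 3.8 (p. 924) and §6, proof of Lemma 6.4 (p. 931)] -/
theorem dualTransported_atLevel_le {inv : LocalInvariants K p} (hur : inv.UnramifiedOrthogonal)
    (hM : ∀ m : M, p • m = 0) {S : Finset (Place K)}
    (hS : ∀ v : HeightOneSpectrum (𝓞 K), (Sum.inr v : Place K) ∉ S →
      ((p : ℕ) : 𝓞 K) ∉ v.asIdeal ∧ GaloisRep.IsUnramifiedAt v ρ)
    {𝓕 : SelmerStructure ρ} (h𝓕 : 𝓕.IsUnramifiedOutside S) (hθθ' : ∀ a : M, θ' (θ a) = a)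
    (hcois : inv.IsResiduallyCoisotropic 𝓕 θ S) {D : KolyvaginDatum ρ}
    (hTθ : ∀ q ∈ D.primes, (inv.dualLocalCondition ρ (Sum.inr q) (D.transverse (Sum.inr q))).comap
      (localMap θ (Sum.inr q)) = D.transverse (Sum.inr q))
    {n : Finset (HeightOneSpectrum (𝓞 K))} (hn : D.IsLevel n) :
    inv.dualTransported (D.atLevel 𝓕 n) θ ≤ D.atLevel 𝓕 n := by
  intro v
  change (inv.dualLocalCondition ρ v (D.atLevel 𝓕 n v)).comap (localMap θ v) ≤ D.atLevel 𝓕 n v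
  rcases v with w | q
  · rw [Level.atLevel_inl]
    exact hcois (Sum.inl w) (h𝓕.1 w)
  · by_cases hqn : q ∈ n
    · rw [Level.atLevel_inr_of_mem D 𝓕 hqn, hTθ q (hn (Finset.mem_coe.2 hqn))]
    · rw [Level.atLevel_inr_of_not_mem D 𝓕 hqn]
      by_cases hqS : (Sum.inr q : Place K) ∈ S
      · exact hcois _ hqS
      · rw [h𝓕.2 q hqS,
          comap_dualLocalCondition_unramifiedSubgroup_eq θ θ' hur hM hθθ' (hS q hqS).1 (hS q hqS).2]

/-- **`H¹_{θ^*𝓕(n)^*}(K, M) ≤ H¹_{𝓕(n)}(K, M)` at every level** under residual coisotropy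
(Sakamoto, proof of Lemma 6.4: "By the coisotropy `𝓕^* ⊂ 𝓕`, we have
`H¹_{𝓕^*(e_i)}(K,T̄) ⊂ H¹_{𝓕(e_i)}(K,T̄)`"). [cite: Sakamoto2024, §6, proof of Lemma 6.4 (p. 931)] -/
theorem selmerGroup_dualTransported_atLevel_le {inv : LocalInvariants K p}
    (hur : inv.UnramifiedOrthogonal) (hM : ∀ m : M, p • m = 0) {S : Finset (Place K)}
    (hS : ∀ v : HeightOneSpectrum (𝓞 K), (Sum.inr v : Place K) ∉ S →
      ((p : ℕ) : 𝓞 K) ∉ v.asIdeal ∧ GaloisRep.IsUnramifiedAt v ρ)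
    {𝓕 : SelmerStructure ρ} (h𝓕 : 𝓕.IsUnramifiedOutside S) (hθθ' : ∀ a : M, θ' (θ a) = a)
    (hcois : inv.IsResiduallyCoisotropic 𝓕 θ S) {D : KolyvaginDatum ρ}
    (hTθ : ∀ q ∈ D.primes, (inv.dualLocalCondition ρ (Sum.inr q) (D.transverse (Sum.inr q))).comap
      (localMap θ (Sum.inr q)) = D.transverse (Sum.inr q))
    {n : Finset (HeightOneSpectrum (𝓞 K))} (hn : D.IsLevel n) :
    (inv.dualTransported (D.atLevel 𝓕 n) θ).selmerGroup ≤ (D.atLevel 𝓕 n).selmerGroup :=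
  selmerGroup_mono (dualTransported_atLevel_le θ θ' hur hM hS h𝓕 hθθ' hcois hTθ hn)

end Theta

end Summit.BirchSwinnertonDyer.Rank1Residual.GaloisImage.CoreRankOne

end
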